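import Literature.Analysis.Hypoelliptic.SymGain
import Mathlib.Algebra.BigOperators.Fin
import HarnessLib

/-!
# Hörmander operators on the Fourier side and the energy inequality of Kohn's proof

Analysis/Hypoelliptic support file, tenth piece of the Fourier-side toolkit serving the
discharge of `Literature.Analysis.Distribution.Hormander1967_thm11` by Kohn's method
(M. Taylor, *Pseudodifferential Operators* (1981), Ch. XV §1).

* `HData V`: the data of a Hörmander operator `P = ∑_j X_j² + X₀ + c` ON THE FOURIER SIDE —
  real, certified, nonempty fields `X_j` (`j : Fin J`), `X₀`, and a certified coefficient
  expression `C` — with the symbolic operator `HData.opP`.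
* Pairings of sums of symbolic operators, and the integration-by-parts identity
  `⟨X G, F⟩ = -⟨G, X F⟩ - ⟨G, (div X) F⟩` for a real field (`HData`-free, `Field.pairing_real`).
* **The energy inequality** (Taylor 1981, Ch. XV, Lemma 1.5, (1.16); Hörmander 1967, (3.1)):
  there is `K` with
  `∑_j ‖X_j F‖₀² ≤ 2 |Re ⟨P F, F⟩| + K ‖F‖₀²` for every `F ∈ Nice`
  (`HData.energy`), and its Cauchy–Schwarz consequence
  `∑_j ‖X_j F‖₀² ≤ ‖P F‖₀² + (K + 1) ‖F‖₀²` (`HData.energy'`).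

## References

* M. E. Taylor, *Pseudodifferential Operators* (1981), Ch. XV §1, Lemma 1.5.
* L. Hörmander, Acta Math. 119 (1967), §3, (3.1).
-/

noncomputable section

open MeasureTheory Set Filter Function
open scoped ENNReal NNReal Topology ComplexConjugate InnerProductSpace BigOperators

namespace Literature.Analysis.Hypoelliptic

variable {V : Type*} [NormedAddCommGroup V] [InnerProductSpace ℝ V] [FiniteDimensional ℝ V]
  [MeasurableSpace V] [BorelSpace V]

/-! ### Pairings of sums; the real norm -/

namespace Sym

/-- The pairing of a symbolic sum is the sum of the pairings. [folklore] -/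
theorem pairing_sum_apply {l : List (Sym V)} (hl : ∀ s ∈ l, Cert s) {F G : V → ℂ} (hF : Nice F)
    (hG : Nice G) :
    pairing (apply (sum l) F) G = (l.map fun s => pairing (apply s F) G).sum := by
  induction l with
  | nil => simp [pairing]
  | cons s l ih =>
    have hl' : ∀ t ∈ l, Cert t := fun t ht => hl t (List.mem_cons_of_mem _ ht)
    rw [sum_cons s l F hF, apply_add, List.map_cons, List.sum_cons,
      pairing_add_left (((hl s List.mem_cons_self).nice_apply hF).inH 0)
        (((cert_sum hl').nice_apply hF).inH 0) (by simpa using hG.inH 0), ih hl']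

end Sym

/-- The real-valued weighted norm `‖F‖_t = (wnorm t F).toReal`. [folklore] -/
def rn (t : ℝ) (F : V → ℂ) : ℝ := (wnorm t F).toReal

/-- (structural lemma) [folklore] -/
theorem rn_nonneg (t : ℝ) (F : V → ℂ) : 0 ≤ rn t F := ENNReal.toReal_nonneg

/-- Monotonicity of the real norms in the level (on `Nice`). [folklore] -/
theorem rn_mono {t t' : ℝ} (h : t' ≤ t) {F : V → ℂ} (hF : Nice F) : rn t' F ≤ rn t F :=
  ENNReal.toReal_mono (hF.2 t).ne (wnorm_mono h F)

/-- The duality bound in real form: `|⟨F, G⟩| ≤ ‖F‖_s ‖G‖_{-s}` on `Nice`. [folklore] -/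
theorem norm_pairing_le_rn (s : ℝ) {F G : V → ℂ} (hF : Nice F) (hG : Nice G) :
    ‖pairing F G‖ ≤ rn s F * rn (-s) G :=
  norm_pairing_le (hF.inH s) (hG.inH (-s))

/-- `|Re z| ≤ ‖z‖`. [folklore] -/
theorem abs_re_le_norm (z : ℂ) : |z.re| ≤ ‖z‖ := Complex.abs_re_le_norm z

/-- `‖F‖₀² = Re ⟨F, F⟩` on `Nice`. [folklore] -/
theorem rn_zero_sq {F : V → ℂ} (hF : Nice F) : rn 0 F ^ 2 = (pairing F F).re := by
  rw [pairing_self (hF.inH 0), Complex.ofReal_re]; rfl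

/-! ### Integration by parts for real fields -/

namespace Field

open Sym

/-- **`⟨X G, F⟩ = -⟨G, X F⟩ - ⟨G, (div X) F⟩`** for a real certified field and `F, G ∈ Nice`
(`X* = -X - div X`). [folklore] -/
theorem pairing_real {X : Field V} (hX : IsField X) (hcX : CertF X) (hr : IsReal X)
    {F G : V → ℂ} (hF : Nice F) (hG : Nice G) :
    pairing ((toSym X).apply G) F =
      -pairing G ((toSym X).apply F) - pairing G ((divF X).apply F) := by
  have hcT := hcX.cert_toSym
  have hcd := hcX.cert_divF hX
  rw [hX.plain_toSym.pairing_apply hcT hG hF, hr.adj_toSym hX hcX F hF, apply_neg, apply_add,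
    pairing_neg_right, pairing_add_right (hG.inH 0) (by simpa using (hcT.nice_apply hF).inH 0)
      (by simpa using (hcd.nice_apply hF).inH 0)]
  ring

/-- **`Re ⟨X F, F⟩ = -½ Re ⟨F, (div X) F⟩`** for a real field: the first-order term has
"purely imaginary principal symbol". [folklore] -/
theorem re_pairing_real_self {X : Field V} (hX : IsField X) (hcX : CertF X) (hr : IsReal X)
    {F : V → ℂ} (hF : Nice F) :
    2 * (pairing ((toSym X).apply F) F).re = -(pairing F ((divF X).apply F)).re := by
  have h := pairing_real hX hcX hr hF hF
  have hc : pairing F ((toSym X).apply F) = conj (pairing ((toSym X).apply F) F) :=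
    pairing_comm _ _
  rw [hc] at h
  -- `z = -conj z - w`
  have hre := congrArg Complex.re h
  simp only [Complex.sub_re, Complex.neg_re, Complex.conj_re] at hre
  linarith

end Field

/-! ### Hörmander operators on the Fourier side -/

variable (V) in
/-- **The Fourier-side data of a Hörmander operator** `P = ∑_{j<J} X_j² + X₀ + c`: real,
certified, nonempty fields `X_j`, `X₀` and a certified coefficient expression `C`.
[folklore] -/
structure HData where
  /-- number of fields in the sum of squares [folklore] -/
  J : ℕ
  /-- the fields `X_j` [folklore] -/
  X : Fin J → Field V
  /-- the drift field `X₀` [folklore] -/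
  X0 : Field V
  /-- the zeroth-order coefficient [folklore] -/
  C : Sym V
  isField : ∀ j, Field.IsField (X j)
  certF : ∀ j, Field.CertF (X j)
  isReal : ∀ j, Field.IsReal (X j)
  ne : ∀ j, X j ≠ []
  isField0 : Field.IsField X0
  certF0 : Field.CertF X0
  isReal0 : Field.IsReal X0
  ne0 : X0 ≠ []
  isCoefC : Sym.IsCoef C
  certC : Sym.Cert C

namespace HData

open Sym

variable (d : HData V)

/-- The symbolic operator of `X_j`. [folklore] -/
abbrev Xs (j : Fin d.J) : Sym V := Field.toSym (d.X j)

/-- The symbolic operator of `X₀`. [folklore] -/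
abbrev X0s : Sym V := Field.toSym d.X0

/-- The divergence coefficient of `X_j`. [folklore] -/
abbrev divX (j : Fin d.J) : Sym V := Field.divF (d.X j)

/-- The divergence coefficient of `X₀`. [folklore] -/
abbrev divX0 : Sym V := Field.divF d.X0

/-- `∑_j X_j²` symbolically. [folklore] -/
def sqSum : Sym V := Sym.sum (List.ofFn fun j : Fin d.J => comp (d.Xs j) (d.Xs j))

/-- **`P = ∑_j X_j² + X₀ + c`** symbolically. [folklore] -/
def opP : Sym V := add (add d.sqSum d.X0s) d.C

omit [InnerProductSpace ℝ V] [FiniteDimensional ℝ V] [BorelSpace V] in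
/-- (structural lemma) [folklore] -/
theorem cert_Xs (j : Fin d.J) : Cert (d.Xs j) := (d.certF j).cert_toSym
omit [InnerProductSpace ℝ V] [FiniteDimensional ℝ V] [BorelSpace V] in
/-- (structural lemma) [folklore] -/
theorem plain_Xs (j : Fin d.J) : Plain (d.Xs j) := (d.isField j).plain_toSym
omit [InnerProductSpace ℝ V] [FiniteDimensional ℝ V] [BorelSpace V] in
/-- (structural lemma) [folklore] -/
theorem cert_X0s : Cert d.X0s := d.certF0.cert_toSym
omit [InnerProductSpace ℝ V] [FiniteDimensional ℝ V] [BorelSpace V] in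
/-- (structural lemma) [folklore] -/
theorem plain_X0s : Plain d.X0s := d.isField0.plain_toSym
omit [FiniteDimensional ℝ V] in
/-- (structural lemma) [folklore] -/
theorem cert_divX (j : Fin d.J) : Cert (d.divX j) := (d.certF j).cert_divF (d.isField j)
omit [FiniteDimensional ℝ V] [BorelSpace V] in
/-- (structural lemma) [folklore] -/
theorem isCoef_divX (j : Fin d.J) : IsCoef (d.divX j) := (d.isField j).isCoef_divF
omit [FiniteDimensional ℝ V] in
/-- (structural lemma) [folklore] -/
theorem cert_divX0 : Cert d.divX0 := d.certF0.cert_divF d.isField0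
omit [FiniteDimensional ℝ V] [BorelSpace V] in
/-- (structural lemma) [folklore] -/
theorem isCoef_divX0 : IsCoef d.divX0 := d.isField0.isCoef_divF

omit [InnerProductSpace ℝ V] [FiniteDimensional ℝ V] [BorelSpace V] in
/-- (structural lemma) [folklore] -/
theorem cert_sqSum : Cert d.sqSum :=
  cert_sum fun s hs => by
    obtain ⟨j, rfl⟩ := List.mem_ofFn.1 hs
    exact ⟨d.cert_Xs j, d.cert_Xs j⟩

omit [InnerProductSpace ℝ V] [FiniteDimensional ℝ V] [BorelSpace V] in
/-- (structural lemma) [folklore] -/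
theorem plain_sqSum : Plain d.sqSum :=
  plain_sum fun s hs => by
    obtain ⟨j, rfl⟩ := List.mem_ofFn.1 hs
    exact ⟨d.plain_Xs j, d.plain_Xs j⟩

omit [InnerProductSpace ℝ V] [FiniteDimensional ℝ V] [BorelSpace V] in
/-- (structural lemma) [folklore] -/
theorem cert_opP : Cert d.opP := ⟨⟨d.cert_sqSum, d.cert_X0s⟩, d.certC⟩
omit [InnerProductSpace ℝ V] [FiniteDimensional ℝ V] [BorelSpace V] in
/-- (structural lemma) [folklore] -/
theorem plain_opP : Plain d.opP := ⟨⟨d.plain_sqSum, d.plain_X0s⟩, d.isCoefC.plain⟩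

/-- The action of `∑ X_j²` is the sum of the actions. [folklore] -/
theorem pairing_sqSum_apply {F G : V → ℂ} (hF : Nice F) (hG : Nice G) :
    pairing (d.sqSum.apply F) G = ∑ j, pairing ((d.Xs j).apply ((d.Xs j).apply F)) G := by
  unfold sqSum
  rw [pairing_sum_apply (fun s hs => ?_) hF hG, List.map_ofFn, Fin.sum_ofFn]
  · rfl
  · obtain ⟨j, rfl⟩ := List.mem_ofFn.1 hs
    exact ⟨d.cert_Xs j, d.cert_Xs j⟩

/-- `⟨P F, G⟩ = ∑_j ⟨X_j X_j F, G⟩ + ⟨X₀ F, G⟩ + ⟨C F, G⟩`. [folklore] -/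
theorem pairing_opP_apply {F G : V → ℂ} (hF : Nice F) (hG : Nice G) :
    pairing (d.opP.apply F) G = (∑ j, pairing ((d.Xs j).apply ((d.Xs j).apply F)) G) +
      pairing (d.X0s.apply F) G + pairing (d.C.apply F) G := by
  unfold opP
  rw [apply_add,
    pairing_add_left ((((cert_add_iff _ _).2 ⟨d.cert_sqSum, d.cert_X0s⟩).nice_apply hF).inH 0)
      ((d.certC.nice_apply hF).inH 0) (by simpa using hG.inH 0),
    apply_add, pairing_add_left ((d.cert_sqSum.nice_apply hF).inH 0)
      ((d.cert_X0s.nice_apply hF).inH 0) (by simpa using hG.inH 0), d.pairing_sqSum_apply hF hG]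

/-! ### The energy inequality -/

/-- The square terms: `Re ⟨X_j X_j F, F⟩ = -‖X_j F‖₀² - Re ⟨X_j F, (div X_j) F⟩`. [folklore] -/
theorem re_pairing_sq (j : Fin d.J) {F : V → ℂ} (hF : Nice F) :
    (pairing ((d.Xs j).apply ((d.Xs j).apply F)) F).re =
      -rn 0 ((d.Xs j).apply F) ^ 2 - (pairing ((d.Xs j).apply F) ((d.divX j).apply F)).re := by
  have hXF : Nice ((d.Xs j).apply F) := (d.cert_Xs j).nice_apply hF
  unfold Xs divX at *
  rw [Field.pairing_real (d.isField j) (d.certF j) (d.isReal j) hF hXF, rn_zero_sq hXF]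
  simp only [Complex.sub_re, Complex.neg_re]

/-- A bound `‖T F‖₀ ≤ c ‖F‖₀` for a certified coefficient expression (order `0`). [folklore] -/
theorem coef_bound {A : Sym V} (hA : IsCoef A) (hc : Cert A) :
    ∃ c : ℝ, 0 ≤ c ∧ ∀ F : V → ℂ, Nice F → rn 0 (A.apply F) ≤ c * rn 0 F := by
  obtain ⟨c, hc0, h⟩ := hc.bound_toReal' (t := 0) (t' := 0) (by rw [hA.ord_eq]; simp)
  exact ⟨c, hc0, h⟩

/-- **The energy inequality** (Taylor 1981, Ch. XV, Lemma 1.5, (1.16); Hörmander 1967, (3.1)):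
there is `K ≥ 0` with `∑_j ‖X_j F‖₀² ≤ 2 |Re ⟨P F, F⟩| + K ‖F‖₀²` for all `F ∈ Nice`
(Fourier-side form). [cite: Taylor1981, Ch. XV §1 Lemma 1.5] -/
theorem energy : ∃ K : ℝ, 0 ≤ K ∧ ∀ F : V → ℂ, Nice F →
    ∑ j, rn 0 ((d.Xs j).apply F) ^ 2 ≤
      2 * |(pairing (d.opP.apply F) F).re| + K * rn 0 F ^ 2 := by
  -- constants of the divergences and of `C`
  choose c hc0 hc using fun j => coef_bound (d.isCoef_divX j) (d.cert_divX j)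
  obtain ⟨c₀, hc₀0, hc₀⟩ := coef_bound d.isCoef_divX0 d.cert_divX0
  obtain ⟨cC, hcC0, hcC⟩ := coef_bound d.isCoefC d.certC
  refine ⟨(∑ j, c j ^ 2) + c₀ + 2 * cC, by positivity, fun F hF => ?_⟩
  set n : ℝ := rn 0 F with hn
  set a : Fin d.J → ℝ := fun j => rn 0 ((d.Xs j).apply F) with ha
  have hn0 : 0 ≤ n := rn_nonneg 0 F
  have ha0 : ∀ j, 0 ≤ a j := fun j => rn_nonneg 0 _
  -- the decomposition of `Re ⟨PF, F⟩`
  have hP := congrArg Complex.re (d.pairing_opP_apply hF hF)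
  simp only [Complex.add_re, Complex.re_sum] at hP
  -- square terms
  have hsq : ∀ j, (pairing ((d.Xs j).apply ((d.Xs j).apply F)) F).re ≤
      -a j ^ 2 + a j * (c j * n) := fun j => by
    rw [d.re_pairing_sq j hF]
    have hXF : Nice ((d.Xs j).apply F) := (d.cert_Xs j).nice_apply hF
    have hdF : Nice ((d.divX j).apply F) := (d.cert_divX j).nice_apply hF
    have h1 := (abs_re_le_norm _).trans (norm_pairing_le_rn 0 hXF hdF)
    rw [neg_zero] at h1
    have h2 : rn 0 ((d.divX j).apply F) ≤ c j * n := hc j F hF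
    have h3 : |(pairing ((d.Xs j).apply F) ((d.divX j).apply F)).re| ≤ a j * (c j * n) :=
      h1.trans (mul_le_mul_of_nonneg_left h2 (ha0 j))
    have := neg_abs_le (pairing ((d.Xs j).apply F) ((d.divX j).apply F)).re
    simp only [ha]
    linarith
  have hsq' : ∀ j, -(pairing ((d.Xs j).apply ((d.Xs j).apply F)) F).re ≥
      a j ^ 2 - a j * (c j * n) := fun j => by have := hsq j; linarith
  -- drift term: `|Re ⟨X₀F, F⟩| ≤ ½ n · c₀ n`
  have h0 : |(pairing (d.X0s.apply F) F).re| ≤ n * (c₀ * n) / 2 := by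
    have h := Field.re_pairing_real_self d.isField0 d.certF0 d.isReal0 hF
    have hdF : Nice (d.divX0.apply F) := d.cert_divX0.nice_apply hF
    have h1 := (abs_re_le_norm _).trans (norm_pairing_le_rn 0 hF hdF)
    rw [neg_zero] at h1
    have h2 := hc₀ F hF
    have h3 : |(pairing F (d.divX0.apply F)).re| ≤ n * (c₀ * n) :=
      h1.trans (mul_le_mul_of_nonneg_left h2 hn0)
    have h4 := neg_abs_le (pairing F (d.divX0.apply F)).re
    have h5 := le_abs_self (pairing F (d.divX0.apply F)).re
    rw [abs_le]
    unfold divX0 X0s at *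
    constructor <;> linarith
  -- zeroth-order term
  have hC : |(pairing (d.C.apply F) F).re| ≤ cC * n * n := by
    have hCF : Nice (d.C.apply F) := d.certC.nice_apply hF
    have h1 := (abs_re_le_norm _).trans (norm_pairing_le_rn 0 hCF hF)
    rw [neg_zero] at h1
    exact h1.trans (mul_le_mul_of_nonneg_right (hcC F hF) hn0)
  -- assemble: `∑ a_j² ≤ |p| + ∑ a_j c_j n + (c₀/2 + cC) n²`
  have hsum : ∑ j, a j ^ 2 ≤ |(pairing (d.opP.apply F) F).re| +
      ∑ j, a j * (c j * n) + (c₀ / 2 + cC) * n ^ 2 := by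
    have hp := neg_abs_le (pairing (d.opP.apply F) F).re
    have h0' := (abs_le.1 h0).2
    have hC' := (abs_le.1 hC).2
    have hs : ∑ j, a j ^ 2 - ∑ j, a j * (c j * n) ≤
        -∑ j, (pairing ((d.Xs j).apply ((d.Xs j).apply F)) F).re := by
      rw [← Finset.sum_sub_distrib, ← Finset.sum_neg_distrib]
      exact Finset.sum_le_sum fun j _ => hsq' j
    nlinarith [hP, hs, hp, h0', hC']
  -- `a_j c_j n ≤ a_j²/2 + c_j² n²/2`
  have hyoung : ∑ j, a j * (c j * n) ≤ (∑ j, a j ^ 2) / 2 + (∑ j, c j ^ 2) * n ^ 2 / 2 := by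
    rw [Finset.sum_div, Finset.sum_mul, Finset.sum_div, ← Finset.sum_add_distrib]
    exact Finset.sum_le_sum fun j _ => by nlinarith [sq_nonneg (a j - c j * n)]
  simp only [ha] at hsum hyoung ⊢
  nlinarith [hsum, hyoung, Finset.sum_nonneg (fun j (_ : j ∈ Finset.univ) => sq_nonneg (c j)),
    sq_nonneg n, abs_nonneg (pairing (d.opP.apply F) F).re]

/-- **The energy inequality, norm form**: `∑_j ‖X_j F‖₀² ≤ ‖P F‖₀² + (K + 1) ‖F‖₀²`.
[folklore] -/
theorem energy' : ∃ K : ℝ, 0 ≤ K ∧ ∀ F : V → ℂ, Nice F →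
    ∑ j, rn 0 ((d.Xs j).apply F) ^ 2 ≤ rn 0 (d.opP.apply F) ^ 2 + K * rn 0 F ^ 2 := by
  obtain ⟨K, hK, h⟩ := d.energy
  refine ⟨K + 1, by linarith, fun F hF => (h F hF).trans ?_⟩
  have hPF : Nice (d.opP.apply F) := d.cert_opP.nice_apply hF
  have h1 := (abs_re_le_norm _).trans (norm_pairing_le_rn 0 hPF hF)
  rw [neg_zero] at h1
  nlinarith [h1, sq_nonneg (rn 0 (d.opP.apply F) - rn 0 F), rn_nonneg 0 F,
    rn_nonneg 0 (d.opP.apply F)]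

/-- Each `‖X_j F‖₀` is controlled: `‖X_j F‖₀ ≤ ‖P F‖₀ + K' ‖F‖₀`. [folklore] -/
theorem rn_Xs_le : ∃ K : ℝ, 0 ≤ K ∧ ∀ (j : Fin d.J) (F : V → ℂ), Nice F →
    rn 0 ((d.Xs j).apply F) ≤ rn 0 (d.opP.apply F) + K * rn 0 F := by
  obtain ⟨K, hK, h⟩ := d.energy'
  refine ⟨Real.sqrt K, Real.sqrt_nonneg K, fun j F hF => ?_⟩
  have h1 : rn 0 ((d.Xs j).apply F) ^ 2 ≤ rn 0 (d.opP.apply F) ^ 2 + K * rn 0 F ^ 2 :=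
    (Finset.single_le_sum (f := fun j => rn 0 ((d.Xs j).apply F) ^ 2) (fun _ _ => sq_nonneg _)
      (Finset.mem_univ j)).trans (h F hF)
  have hsK := Real.sq_sqrt hK
  have hnn : 0 ≤ rn 0 (d.opP.apply F) + Real.sqrt K * rn 0 F :=
    add_nonneg (rn_nonneg _ _) (mul_nonneg (Real.sqrt_nonneg K) (rn_nonneg _ _))
  nlinarith [h1, hsK, rn_nonneg 0 ((d.Xs j).apply F), rn_nonneg 0 F,
    rn_nonneg 0 (d.opP.apply F), Real.sqrt_nonneg K,
    mul_nonneg (mul_nonneg (Real.sqrt_nonneg K) (rn_nonneg 0 F)) (rn_nonneg 0 (d.opP.apply F))]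

end HData

end Literature.Analysis.Hypoelliptic
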